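import Mathlib.Analysis.Calculus.ParametricIntervalIntegral
import Literature.Analysis.Complex.WeightedArgumentPrinciple
import HarnessLib

/-!
# Variation of the weighted zero sums of a holomorphic family (rectangle contour)

Trunk T-ANALYSIS support (`Literature/Analysis/Complex`). For a family `f_t` of entire functions
depending differentiably on a real parameter `t`, the weighted argument principle
(`Literature.Analysis.Complex.integral_boundary_rect_logDeriv_mul`: `∮_{∂K} (f_t'/f_t) g = 2πi Σ_ρ m_t(ρ) g(ρ)`, sum
over the zeros of `f_t` in the open rectangle `K°`) turns statements about the motion of the zeros
of `f_t` inside a fixed rectangle `K` (no zeros on `∂K`) into statements about a parametric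
contour integral. This file supplies the calculus of that integral:

* `Literature.Analysis.Complex.rectBoundaryIntegral_deriv_eq_zero` — `∮_{∂K} h' = 0` for `h` analytic at every
  point of `∂K` (fundamental theorem of calculus on the four edges; no hypothesis inside `K`);
* `Literature.Analysis.Complex.exists_forall_ne_zero_nhds_of_compact` — if `F(t₁, ·)` has no zero on a compact set
  `S` and `F` is jointly continuous, then `F(t, ·)` has no zero on `S` for `|t − t₁| ≤ δ`;
* `Literature.Analysis.Complex.hasDerivAt_rectBoundaryIntegral_logDeriv_mul` — **the variation formula**: if
  `∂_t f_t = fd_t` and `∂_t f_t' = fd_t'` pointwise, all four of `f, f', fd, fd'` are jointly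
  continuous in `(t, w)`, and `f_{t₁} ≠ 0` on `∂K`, then
  `d/dt|_{t = t₁} ∮_{∂K} (f_t'/f_t) g = −∮_{∂K} (fd_{t₁}/f_{t₁}) g'`
  (differentiate under the integral sign, `∂_t (f'/f) = ∂_w (fd/f)`, and integrate by parts on the
  closed contour). With `g ≡ 1` the derivative vanishes (the number of zeros in `K` is locally
  constant); with `g(w) = w` one gets the velocity of the sum of the zeros in `K`,
  `−(1/2πi) ∮ fd/f`, which for a solution of the backwards heat equation `fd = −f''` is
  `(1/2πi) ∮ f''/f` (cf. Polymath 15, Res. Math. Sci. 6 (2019), Prop. 3.1 and eq. (tzj):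
  `ż_j = H_t''/H_t'(z_j)` for a simple zero).

Textbook background: the argument principle with a weight (Conway, *Functions of One Complex
Variable I*, V.3.6) and differentiation of parametric integrals.

## References

* J. B. Conway, *Functions of One Complex Variable I*, 2nd ed., GTM 11, Springer 1978, Ch. V §3.
* D. H. J. Polymath, *Effective approximation of heat flow evolution of the Riemann `ξ` function,
  and a new upper bound for the de Bruijn–Newman constant*, Res. Math. Sci. 6 (2019), §3
  (arXiv:1904.12438).
-/

noncomputable section

open Complex Set Filter Topology MeasureTheory intervalIntegral
open scoped Interval

namespace Literature.Analysis.Complex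

variable {a b c d : ℝ}

/-! ## `∮_{∂K} h' = 0` -/

/-- Fundamental theorem of calculus along a horizontal edge: `∫_a^b h'(x + iy) dx =
h(b + iy) − h(a + iy)` for `h` analytic at every point of the edge. [folklore] -/
theorem integral_deriv_horizontal {h : ℂ → ℂ} (y : ℝ) (hab : a ≤ b)
    (hh : ∀ x ∈ Icc a b, AnalyticAt ℂ h (x + y * I)) :
    ∫ x : ℝ in a..b, deriv h (x + y * I) = h (b + y * I) - h (a + y * I) := by
  apply integral_eq_sub_of_hasDerivAt
  · intro x hx
    rw [uIcc_of_le hab] at hx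
    have h1 : HasDerivAt h (deriv h (x + y * I)) ((x : ℂ) + y * I) :=
      (hh x hx).differentiableAt.hasDerivAt
    have h2 : HasDerivAt (fun w : ℂ ↦ h (w + y * I)) (deriv h (x + y * I) * 1) (x : ℂ) :=
      h1.comp (x : ℂ) ((hasDerivAt_id (x : ℂ)).add_const ((y : ℂ) * I))
    simpa using h2.comp_ofReal
  · exact intervalIntegrable_of_continuousAt_horizontal y hab fun x hx ↦
      (hh x hx).deriv.continuousAt

/-- Fundamental theorem of calculus along a vertical edge: `i ∫_c^d h'(x + iy) dy =
h(x + id) − h(x + ic)` for `h` analytic at every point of the edge. [folklore] -/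
theorem I_mul_integral_deriv_vertical {h : ℂ → ℂ} (x : ℝ) (hcd : c ≤ d)
    (hh : ∀ y ∈ Icc c d, AnalyticAt ℂ h (x + y * I)) :
    I * ∫ y : ℝ in c..d, deriv h (x + y * I) = h (x + d * I) - h (x + c * I) := by
  rw [← intervalIntegral.integral_const_mul]
  apply integral_eq_sub_of_hasDerivAt
  · intro y hy
    rw [uIcc_of_le hcd] at hy
    have h1 : HasDerivAt h (deriv h (x + y * I)) ((x : ℂ) + y * I) :=
      (hh y hy).differentiableAt.hasDerivAt
    have hl : HasDerivAt (fun w : ℂ ↦ (x : ℂ) + w * I) I (y : ℂ) := by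
      simpa using ((hasDerivAt_id (y : ℂ)).mul_const I).const_add (x : ℂ)
    have h2 : HasDerivAt (fun w : ℂ ↦ h (x + w * I)) (deriv h (x + y * I) * I) (y : ℂ) :=
      h1.comp (y : ℂ) hl
    have h3 := h2.comp_ofReal
    rw [mul_comm] at h3
    exact h3
  · exact (intervalIntegrable_of_continuousAt_vertical x hcd
      fun y hy ↦ (hh y hy).deriv.continuousAt).const_mul I

/-- **`∮_{∂K} h' = 0`** for `h` analytic at every point of the boundary of the rectangle
`K = [a,b] × [c,d]` (four-term convention `rectBoundaryIntegral`; nothing is assumed inside `K`):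
the edge integrals are differences of values of `h` at the corners, which cancel. [folklore] -/
theorem rectBoundaryIntegral_deriv_eq_zero {h : ℂ → ℂ} (hab : a ≤ b) (hcd : c ≤ d)
    (h_bot : ∀ x ∈ Icc a b, AnalyticAt ℂ h (x + c * I))
    (h_top : ∀ x ∈ Icc a b, AnalyticAt ℂ h (x + d * I))
    (h_left : ∀ y ∈ Icc c d, AnalyticAt ℂ h (a + y * I))
    (h_right : ∀ y ∈ Icc c d, AnalyticAt ℂ h (b + y * I)) :
    rectBoundaryIntegral (deriv h) a b c d = 0 := by
  rw [rectBoundaryIntegral, integral_deriv_horizontal c hab h_bot,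
    integral_deriv_horizontal d hab h_top,
    I_mul_integral_deriv_vertical b hcd h_right, I_mul_integral_deriv_vertical a hcd h_left]
  ring

/-! ## Stability of non-vanishing on a compact set -/

/-- If `F` is jointly continuous and `F(t₁, ·)` has no zero on the compact set `S`, then for some
`δ > 0`, `F(t, ·)` has no zero on `S` whenever `|t − t₁| ≤ δ`. [folklore] -/
theorem exists_forall_ne_zero_nhds_of_compact {F : ℝ × ℂ → ℂ} (hF : Continuous F) {S : Set ℂ}
    (hS : IsCompact S) {t₁ : ℝ} (h0 : ∀ w ∈ S, F (t₁, w) ≠ 0) :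
    ∃ δ > 0, ∀ t : ℝ, |t - t₁| ≤ δ → ∀ w ∈ S, F (t, w) ≠ 0 := by
  have hev : ∀ᶠ t in 𝓝 t₁, ∀ w ∈ S, F (t, w) ≠ 0 := by
    refine hS.eventually_forall_of_forall_eventually fun w hw ↦ ?_
    exact (hF.continuousAt (x := (t₁, w))).eventually_ne (h0 w hw)
  obtain ⟨ε, hε, hball⟩ := Metric.eventually_nhds_iff.1 hev
  refine ⟨ε / 2, half_pos hε, fun t ht w hw ↦ hball ?_ w hw⟩
  rw [Real.dist_eq]
  linarith

/-! ## Differentiating the edge integrals in the parameter -/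

section Family

variable {f fd : ℝ → ℂ → ℂ} {g : ℂ → ℂ} {t₁ : ℝ}

/-- The `t`-derivative of `(f_t'/f_t)(w) g(w)` at a point where `f_t(w) ≠ 0`:
`((fd_t)'(w) f_t(w) − f_t'(w) fd_t(w)) / f_t(w)² · g(w)`. [folklore] -/
def logDerivVariation (f fd : ℝ → ℂ → ℂ) (g : ℂ → ℂ) (t : ℝ) (w : ℂ) : ℂ :=
  (deriv (fd t) w * f t w - deriv (f t) w * fd t w) / (f t w) ^ 2 * g w

/-- Pointwise `t`-derivative of the integrand `(f_t'/f_t) g`. [folklore] -/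
theorem hasDerivAt_logDeriv_mul (hft : ∀ t w, HasDerivAt (fun s ↦ f s w) (fd t w) t)
    (hf't : ∀ t w, HasDerivAt (fun s ↦ deriv (f s) w) (deriv (fd t) w) t) {t : ℝ} {w : ℂ}
    (h0 : f t w ≠ 0) :
    HasDerivAt (fun s ↦ deriv (f s) w / f s w * g w) (logDerivVariation f fd g t w) t := by
  unfold logDerivVariation
  exact ((hf't t w).div (hft t w) h0).mul_const (g w)

/-- Joint continuity of `(t, w) ↦ (f_t'/f_t)(w) g(w)` where `f ≠ 0`. [folklore] -/
theorem continuousAt_logDeriv_mul_uncurry (hfc : Continuous (Function.uncurry f))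
    (hf'c : Continuous fun p : ℝ × ℂ ↦ deriv (f p.1) p.2) (hg : Continuous g) {p : ℝ × ℂ}
    (h0 : f p.1 p.2 ≠ 0) :
    ContinuousAt (fun q : ℝ × ℂ ↦ deriv (f q.1) q.2 / f q.1 q.2 * g q.2) p :=
  ((hf'c.continuousAt.div (hfc.continuousAt (x := p)) h0).mul
    (hg.continuousAt.comp continuousAt_snd))

/-- Joint continuity of the `t`-derivative `logDerivVariation` where `f ≠ 0`. [folklore] -/
theorem continuousAt_logDerivVariation_uncurry (hfc : Continuous (Function.uncurry f))
    (hf'c : Continuous fun p : ℝ × ℂ ↦ deriv (f p.1) p.2) (hfdc : Continuous (Function.uncurry fd))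
    (hfd'c : Continuous fun p : ℝ × ℂ ↦ deriv (fd p.1) p.2) (hg : Continuous g) {p : ℝ × ℂ}
    (h0 : f p.1 p.2 ≠ 0) :
    ContinuousAt (fun q : ℝ × ℂ ↦ logDerivVariation f fd g q.1 q.2) p := by
  unfold logDerivVariation
  have hf₀ : ContinuousAt (fun q : ℝ × ℂ ↦ f q.1 q.2) p := hfc.continuousAt (x := p)
  have hfd₀ : ContinuousAt (fun q : ℝ × ℂ ↦ fd q.1 q.2) p := hfdc.continuousAt (x := p)
  exact ((((hfd'c.continuousAt.mul hf₀).sub (hf'c.continuousAt.mul hfd₀)).div (hf₀.pow 2)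
    (pow_ne_zero 2 h0)).mul (hg.continuousAt.comp continuousAt_snd))

/-- **Differentiation under the integral sign along a horizontal edge.** If `f_t ≠ 0` on the
edge `[a,b] + iy` for `|t − t₁| ≤ δ`, then `t ↦ ∫_a^b (f_t'/f_t) g (x + iy) dx` has derivative
`∫_a^b logDerivVariation (x + iy) dx` at `t₁`. [folklore] -/
theorem hasDerivAt_integral_logDeriv_mul_horizontal (y : ℝ) (hab : a ≤ b)
    (hft : ∀ t w, HasDerivAt (fun s ↦ f s w) (fd t w) t)
    (hf't : ∀ t w, HasDerivAt (fun s ↦ deriv (f s) w) (deriv (fd t) w) t)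
    (hfc : Continuous (Function.uncurry f)) (hf'c : Continuous fun p : ℝ × ℂ ↦ deriv (f p.1) p.2)
    (hfdc : Continuous (Function.uncurry fd))
    (hfd'c : Continuous fun p : ℝ × ℂ ↦ deriv (fd p.1) p.2)
    (hg : Continuous g) {δ : ℝ} (hδ : 0 < δ)
    (h0 : ∀ t : ℝ, |t - t₁| ≤ δ → ∀ x ∈ Icc a b, f t (x + y * I) ≠ 0) :
    HasDerivAt (fun t ↦ ∫ x : ℝ in a..b, deriv (f t) (x + y * I) / f t (x + y * I) * g (x + y * I))
      (∫ x : ℝ in a..b, logDerivVariation f fd g t₁ (x + y * I)) t₁ := by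
  -- the compact parameter × edge set and a uniform bound for the `t`-derivative there
  have hTc : IsCompact (Icc (t₁ - δ) (t₁ + δ) ×ˢ Icc a b) := isCompact_Icc.prod isCompact_Icc
  have hG : ContinuousOn (fun q : ℝ × ℝ ↦ logDerivVariation f fd g q.1 (q.2 + y * I))
      (Icc (t₁ - δ) (t₁ + δ) ×ˢ Icc a b) := by
    intro q hq
    rw [Set.mem_prod] at hq
    have hq1 : |q.1 - t₁| ≤ δ := abs_le.2 ⟨by linarith [hq.1.1], by linarith [hq.1.2]⟩
    have hq2 : q.2 ∈ Icc a b := hq.2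
    have hne := h0 q.1 hq1 q.2 hq2
    have hφ : Continuous fun q : ℝ × ℝ ↦ ((q.1, (q.2 : ℂ) + y * I) : ℝ × ℂ) := by fun_prop
    exact (ContinuousAt.comp (f := fun q : ℝ × ℝ ↦ ((q.1, (q.2 : ℂ) + y * I) : ℝ × ℂ)) (x := q)
      (continuousAt_logDerivVariation_uncurry hfc hf'c hfdc hfd'c hg
        (p := (q.1, (q.2 : ℂ) + y * I)) hne) hφ.continuousAt).continuousWithinAt
  obtain ⟨M, hM⟩ := hTc.exists_bound_of_continuousOn hG
  -- continuity of `x ↦ F t x` along the edge for `|t - t₁| ≤ δ`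
  have hFcont : ∀ t : ℝ, |t - t₁| ≤ δ →
      ContinuousOn (fun x : ℝ ↦ deriv (f t) (x + y * I) / f t (x + y * I) * g (x + y * I))
        (Icc a b) := by
    intro t ht x hx
    have hφ : Continuous fun x : ℝ ↦ ((t, (x : ℂ) + y * I) : ℝ × ℂ) := by fun_prop
    exact (ContinuousAt.comp (f := fun x : ℝ ↦ ((t, (x : ℂ) + y * I) : ℝ × ℂ)) (x := x)
      (continuousAt_logDeriv_mul_uncurry hfc hf'c hg (p := (t, (x : ℂ) + y * I))
        (h0 t ht x hx)) hφ.continuousAt).continuousWithinAt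
  -- continuity of `x ↦ F' t₁ x` along the edge
  have hF'cont : ContinuousOn (fun x : ℝ ↦ logDerivVariation f fd g t₁ (x + y * I)) (Icc a b) := by
    intro x hx
    have hφ : Continuous fun x : ℝ ↦ ((t₁, (x : ℂ) + y * I) : ℝ × ℂ) := by fun_prop
    exact (ContinuousAt.comp (f := fun x : ℝ ↦ ((t₁, (x : ℂ) + y * I) : ℝ × ℂ)) (x := x)
      (continuousAt_logDerivVariation_uncurry hfc hf'c hfdc hfd'c hg
        (p := (t₁, (x : ℂ) + y * I)) (h0 t₁ (by simp [hδ.le]) x hx)) hφ.continuousAt)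
      |>.continuousWithinAt
  have hIoc : Ι a b = Ioc a b := uIoc_of_le hab
  have hball : ∀ t ∈ Metric.closedBall t₁ δ, |t - t₁| ≤ δ := fun t ht ↦ by
    rwa [Metric.mem_closedBall, Real.dist_eq] at ht
  -- name the integrand and its `t`-derivative
  obtain ⟨F, hF⟩ : ∃ F : ℝ → ℝ → ℂ,
      ∀ t x, F t x = deriv (f t) (x + y * I) / f t (x + y * I) * g (x + y * I) :=
    ⟨_, fun _ _ ↦ rfl⟩
  obtain ⟨F', hF'⟩ : ∃ F' : ℝ → ℝ → ℂ, ∀ t x, F' t x = logDerivVariation f fd g t (x + y * I) :=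
    ⟨_, fun _ _ ↦ rfl⟩
  have h1 : ∀ᶠ t in 𝓝 t₁, AEStronglyMeasurable (F t) (volume.restrict (Ι a b)) := by
    filter_upwards [Metric.closedBall_mem_nhds t₁ hδ] with t ht
    rw [hIoc, show F t = fun x : ℝ ↦ deriv (f t) (x + y * I) / f t (x + y * I) * g (x + y * I) from
      funext (hF t)]
    exact ((hFcont t (hball t ht)).mono Ioc_subset_Icc_self).aestronglyMeasurable measurableSet_Ioc
  have h2 : IntervalIntegrable (F t₁) volume a b := by
    refine ContinuousOn.intervalIntegrable ?_
    rw [uIcc_of_le hab, show F t₁ = fun x : ℝ ↦ deriv (f t₁) (x + y * I) / f t₁ (x + y * I) *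
      g (x + y * I) from funext (hF t₁)]
    exact hFcont t₁ (by simp [hδ.le])
  have h3 : AEStronglyMeasurable (F' t₁) (volume.restrict (Ι a b)) := by
    rw [hIoc, show F' t₁ = fun x : ℝ ↦ logDerivVariation f fd g t₁ (x + y * I) from funext (hF' t₁)]
    exact (hF'cont.mono Ioc_subset_Icc_self).aestronglyMeasurable measurableSet_Ioc
  have h4 : ∀ᵐ x ∂volume, x ∈ Ι a b → ∀ t ∈ Metric.closedBall t₁ δ, ‖F' t x‖ ≤ (fun _ ↦ M) x := by
    refine Eventually.of_forall fun x hx t ht ↦ ?_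
    rw [hF']
    have := hball t ht
    rw [hIoc] at hx
    exact hM (t, x) (Set.mk_mem_prod ⟨by linarith [(abs_le.1 this).1],
      by linarith [(abs_le.1 this).2]⟩ (Ioc_subset_Icc_self hx))
  have h5 : IntervalIntegrable (fun _ ↦ M) volume a b := intervalIntegrable_const
  have h6 : ∀ᵐ x ∂volume, x ∈ Ι a b → ∀ t ∈ Metric.closedBall t₁ δ,
      HasDerivAt (fun s ↦ F s x) (F' t x) t := by
    refine Eventually.of_forall fun x hx t ht ↦ ?_
    rw [hIoc] at hx
    rw [hF', show (fun s ↦ F s x) = fun s : ℝ ↦ deriv (f s) (x + y * I) / f s (x + y * I) *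
      g (x + y * I) from funext fun s ↦ hF s x]
    exact hasDerivAt_logDeriv_mul hft hf't (h0 t (hball t ht) x (Ioc_subset_Icc_self hx))
  have key := (intervalIntegral.hasDerivAt_integral_of_dominated_loc_of_deriv_le (𝕜 := ℝ)
    (Metric.closedBall_mem_nhds t₁ hδ) h1 h2 h3 h4 h5 h6).2
  simp only [hF, hF'] at key
  exact key

/-- **Differentiation under the integral sign along a vertical edge** (see the horizontal
case). [folklore] -/
theorem hasDerivAt_integral_logDeriv_mul_vertical (x : ℝ) (hcd : c ≤ d)
    (hft : ∀ t w, HasDerivAt (fun s ↦ f s w) (fd t w) t)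
    (hf't : ∀ t w, HasDerivAt (fun s ↦ deriv (f s) w) (deriv (fd t) w) t)
    (hfc : Continuous (Function.uncurry f)) (hf'c : Continuous fun p : ℝ × ℂ ↦ deriv (f p.1) p.2)
    (hfdc : Continuous (Function.uncurry fd))
    (hfd'c : Continuous fun p : ℝ × ℂ ↦ deriv (fd p.1) p.2)
    (hg : Continuous g) {δ : ℝ} (hδ : 0 < δ)
    (h0 : ∀ t : ℝ, |t - t₁| ≤ δ → ∀ y ∈ Icc c d, f t (x + y * I) ≠ 0) :
    HasDerivAt (fun t ↦ ∫ y : ℝ in c..d, deriv (f t) (x + y * I) / f t (x + y * I) * g (x + y * I))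
      (∫ y : ℝ in c..d, logDerivVariation f fd g t₁ (x + y * I)) t₁ := by
  have hTc : IsCompact (Icc (t₁ - δ) (t₁ + δ) ×ˢ Icc c d) := isCompact_Icc.prod isCompact_Icc
  have hG : ContinuousOn (fun q : ℝ × ℝ ↦ logDerivVariation f fd g q.1 (x + q.2 * I))
      (Icc (t₁ - δ) (t₁ + δ) ×ˢ Icc c d) := by
    intro q hq
    rw [Set.mem_prod] at hq
    have hq1 : |q.1 - t₁| ≤ δ := abs_le.2 ⟨by linarith [hq.1.1], by linarith [hq.1.2]⟩
    have hq2 : q.2 ∈ Icc c d := hq.2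
    have hne := h0 q.1 hq1 q.2 hq2
    have hφ : Continuous fun q : ℝ × ℝ ↦ ((q.1, (x : ℂ) + q.2 * I) : ℝ × ℂ) := by fun_prop
    exact (ContinuousAt.comp (f := fun q : ℝ × ℝ ↦ ((q.1, (x : ℂ) + q.2 * I) : ℝ × ℂ)) (x := q)
      (continuousAt_logDerivVariation_uncurry hfc hf'c hfdc hfd'c hg
        (p := (q.1, (x : ℂ) + q.2 * I)) hne) hφ.continuousAt).continuousWithinAt
  obtain ⟨M, hM⟩ := hTc.exists_bound_of_continuousOn hG
  have hFcont : ∀ t : ℝ, |t - t₁| ≤ δ →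
      ContinuousOn (fun y : ℝ ↦ deriv (f t) (x + y * I) / f t (x + y * I) * g (x + y * I))
        (Icc c d) := by
    intro t ht y hy
    have hφ : Continuous fun y : ℝ ↦ ((t, (x : ℂ) + y * I) : ℝ × ℂ) := by fun_prop
    exact (ContinuousAt.comp (f := fun y : ℝ ↦ ((t, (x : ℂ) + y * I) : ℝ × ℂ)) (x := y)
      (continuousAt_logDeriv_mul_uncurry hfc hf'c hg (p := (t, (x : ℂ) + y * I))
        (h0 t ht y hy)) hφ.continuousAt).continuousWithinAt
  have hF'cont : ContinuousOn (fun y : ℝ ↦ logDerivVariation f fd g t₁ (x + y * I)) (Icc c d) := by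
    intro y hy
    have hφ : Continuous fun y : ℝ ↦ ((t₁, (x : ℂ) + y * I) : ℝ × ℂ) := by fun_prop
    exact (ContinuousAt.comp (f := fun y : ℝ ↦ ((t₁, (x : ℂ) + y * I) : ℝ × ℂ)) (x := y)
      (continuousAt_logDerivVariation_uncurry hfc hf'c hfdc hfd'c hg
        (p := (t₁, (x : ℂ) + y * I)) (h0 t₁ (by simp [hδ.le]) y hy)) hφ.continuousAt)
      |>.continuousWithinAt
  have hIoc : Ι c d = Ioc c d := uIoc_of_le hcd
  have hball : ∀ t ∈ Metric.closedBall t₁ δ, |t - t₁| ≤ δ := fun t ht ↦ by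
    rwa [Metric.mem_closedBall, Real.dist_eq] at ht
  obtain ⟨F, hF⟩ : ∃ F : ℝ → ℝ → ℂ,
      ∀ t y, F t y = deriv (f t) (x + y * I) / f t (x + y * I) * g (x + y * I) :=
    ⟨_, fun _ _ ↦ rfl⟩
  obtain ⟨F', hF'⟩ : ∃ F' : ℝ → ℝ → ℂ, ∀ t y, F' t y = logDerivVariation f fd g t (x + y * I) :=
    ⟨_, fun _ _ ↦ rfl⟩
  have h1 : ∀ᶠ t in 𝓝 t₁, AEStronglyMeasurable (F t) (volume.restrict (Ι c d)) := by
    filter_upwards [Metric.closedBall_mem_nhds t₁ hδ] with t ht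
    rw [hIoc, show F t = fun y : ℝ ↦ deriv (f t) (x + y * I) / f t (x + y * I) * g (x + y * I) from
      funext (hF t)]
    exact ((hFcont t (hball t ht)).mono Ioc_subset_Icc_self).aestronglyMeasurable measurableSet_Ioc
  have h2 : IntervalIntegrable (F t₁) volume c d := by
    refine ContinuousOn.intervalIntegrable ?_
    rw [uIcc_of_le hcd, show F t₁ = fun y : ℝ ↦ deriv (f t₁) (x + y * I) / f t₁ (x + y * I) *
      g (x + y * I) from funext (hF t₁)]
    exact hFcont t₁ (by simp [hδ.le])
  have h3 : AEStronglyMeasurable (F' t₁) (volume.restrict (Ι c d)) := by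
    rw [hIoc, show F' t₁ = fun y : ℝ ↦ logDerivVariation f fd g t₁ (x + y * I) from funext (hF' t₁)]
    exact (hF'cont.mono Ioc_subset_Icc_self).aestronglyMeasurable measurableSet_Ioc
  have h4 : ∀ᵐ y ∂volume, y ∈ Ι c d → ∀ t ∈ Metric.closedBall t₁ δ, ‖F' t y‖ ≤ (fun _ ↦ M) y := by
    refine Eventually.of_forall fun y hy t ht ↦ ?_
    rw [hF']
    have := hball t ht
    rw [hIoc] at hy
    exact hM (t, y) (Set.mk_mem_prod ⟨by linarith [(abs_le.1 this).1],
      by linarith [(abs_le.1 this).2]⟩ (Ioc_subset_Icc_self hy))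
  have h5 : IntervalIntegrable (fun _ ↦ M) volume c d := intervalIntegrable_const
  have h6 : ∀ᵐ y ∂volume, y ∈ Ι c d → ∀ t ∈ Metric.closedBall t₁ δ,
      HasDerivAt (fun s ↦ F s y) (F' t y) t := by
    refine Eventually.of_forall fun y hy t ht ↦ ?_
    rw [hIoc] at hy
    rw [hF', show (fun s ↦ F s y) = fun s : ℝ ↦ deriv (f s) (x + y * I) / f s (x + y * I) *
      g (x + y * I) from funext fun s ↦ hF s y]
    exact hasDerivAt_logDeriv_mul hft hf't (h0 t (hball t ht) y (Ioc_subset_Icc_self hy))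
  have key := (intervalIntegral.hasDerivAt_integral_of_dominated_loc_of_deriv_le (𝕜 := ℝ)
    (Metric.closedBall_mem_nhds t₁ hδ) h1 h2 h3 h4 h5 h6).2
  simp only [hF, hF'] at key
  exact key

/-! ## The variation formula -/

/-- The boundary of the rectangle `[a,b] × [c,d]` as a subset of `ℂ`: the union of the four
closed edges. For `a ≤ b`, `c ≤ d` (the only case in which it is used) this is the frontier of
`Icc a b ×ℂ Icc c d`; for `a > b` or `c > d` it is a non-empty set although the rectangle is empty.
[folklore] -/
def rectBoundarySet (a b c d : ℝ) : Set ℂ :=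
  ((fun x : ℝ ↦ (x : ℂ) + c * I) '' Icc a b ∪ (fun x : ℝ ↦ (x : ℂ) + d * I) '' Icc a b) ∪
    ((fun y : ℝ ↦ (a : ℂ) + y * I) '' Icc c d ∪ (fun y : ℝ ↦ (b : ℂ) + y * I) '' Icc c d)

/-- The boundary of a rectangle is compact. [folklore] -/
theorem isCompact_rectBoundarySet (a b c d : ℝ) : IsCompact (rectBoundarySet a b c d) :=
  ((isCompact_Icc.image (by fun_prop)).union (isCompact_Icc.image (by fun_prop))).union
    ((isCompact_Icc.image (by fun_prop)).union (isCompact_Icc.image (by fun_prop)))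

/-- At a point where `f_{t₁} ≠ 0`, the `t`-derivative of `(f_t'/f_t) g` at `t₁` is
`(fd/f)' g = ((fd/f) g)' − (fd/f) g'` (`∂_t (f'/f) = ∂_w (ḟ/f)`: both are
`(ḟ' f − f' ḟ)/f²`). [folklore] -/
theorem logDerivVariation_eq {t : ℝ} (hf₁ : Differentiable ℂ (f t)) (hfd₁ : Differentiable ℂ (fd t))
    (hg : Differentiable ℂ g) {w : ℂ} (h0 : f t w ≠ 0) :
    logDerivVariation f fd g t w =
      deriv (fun w ↦ fd t w / f t w * g w) w + (-1) * (fd t w / f t w * deriv g w) := by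
  have hQ : DifferentiableAt ℂ (fun w ↦ fd t w / f t w) w := (hfd₁ w).div (hf₁ w) h0
  rw [deriv_fun_mul hQ (hg w), deriv_fun_div (hfd₁ w) (hf₁ w) h0, logDerivVariation]
  ring

/-- **Variation of the weighted zero sum.** Let `f_t`, `ḟ_t = ∂_t f_t` be a family of functions
on `ℂ` with `∂_t f_t(w) = ḟ_t(w)` and `∂_t f_t'(w) = ḟ_t'(w)` for all `t, w`, all four of
`f_t(w)`, `f_t'(w)`, `ḟ_t(w)`, `ḟ_t'(w)` jointly continuous in `(t, w)`, `f_{t₁}` and `ḟ_{t₁}`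
entire, `g` entire, and `f_{t₁} ≠ 0` on the boundary of `K = [a,b] × [c,d]`. Then
`t ↦ ∮_{∂K} (f_t'/f_t) g` is differentiable at `t₁` with derivative `−∮_{∂K} (ḟ_{t₁}/f_{t₁}) g'`.
(Differentiate under the integral sign; the derivative of the integrand is `((ḟ/f) g)' − (ḟ/f) g'`
and `∮ ((ḟ/f) g)' = 0`.) By the weighted argument principle the left side is
`2πi Σ_ρ m_t(ρ) g(ρ)` over the zeros of `f_t` in `K°` whenever `f_t` is analytic on `K` and
zero-free on `∂K` (`rectBoundaryIntegral_logDeriv_mul_eq_finsum`). [folklore] -/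
theorem hasDerivAt_rectBoundaryIntegral_logDeriv_mul (hab : a ≤ b) (hcd : c ≤ d)
    (hft : ∀ t w, HasDerivAt (fun s ↦ f s w) (fd t w) t)
    (hf't : ∀ t w, HasDerivAt (fun s ↦ deriv (f s) w) (deriv (fd t) w) t)
    (hfc : Continuous (Function.uncurry f)) (hf'c : Continuous fun p : ℝ × ℂ ↦ deriv (f p.1) p.2)
    (hfdc : Continuous (Function.uncurry fd))
    (hfd'c : Continuous fun p : ℝ × ℂ ↦ deriv (fd p.1) p.2)
    (hf₁ : Differentiable ℂ (f t₁)) (hfd₁ : Differentiable ℂ (fd t₁)) (hg : Differentiable ℂ g)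
    (h0 : ∀ w ∈ rectBoundarySet a b c d, f t₁ w ≠ 0) :
    HasDerivAt (fun t ↦ rectBoundaryIntegral (fun w ↦ deriv (f t) w / f t w * g w) a b c d)
      (-rectBoundaryIntegral (fun w ↦ fd t₁ w / f t₁ w * deriv g w) a b c d) t₁ := by
  -- non-vanishing on the boundary for `|t - t₁| ≤ δ`
  obtain ⟨δ, hδ, hne⟩ := exists_forall_ne_zero_nhds_of_compact (F := Function.uncurry f) hfc
    (isCompact_rectBoundarySet a b c d) h0
  have h_bot : ∀ t : ℝ, |t - t₁| ≤ δ → ∀ x ∈ Icc a b, f t (x + c * I) ≠ 0 :=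
    fun t ht x hx ↦ hne t ht _ (Or.inl (Or.inl ⟨x, hx, rfl⟩))
  have h_top : ∀ t : ℝ, |t - t₁| ≤ δ → ∀ x ∈ Icc a b, f t (x + d * I) ≠ 0 :=
    fun t ht x hx ↦ hne t ht _ (Or.inl (Or.inr ⟨x, hx, rfl⟩))
  have h_left : ∀ t : ℝ, |t - t₁| ≤ δ → ∀ y ∈ Icc c d, f t (a + y * I) ≠ 0 :=
    fun t ht y hy ↦ hne t ht _ (Or.inr (Or.inl ⟨y, hy, rfl⟩))
  have h_right : ∀ t : ℝ, |t - t₁| ≤ δ → ∀ y ∈ Icc c d, f t (b + y * I) ≠ 0 :=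
    fun t ht y hy ↦ hne t ht _ (Or.inr (Or.inr ⟨y, hy, rfl⟩))
  have hgc : Continuous g := hg.continuous
  -- differentiate the four edge integrals
  have e_bot := hasDerivAt_integral_logDeriv_mul_horizontal c hab hft hf't hfc hf'c hfdc hfd'c hgc
    hδ h_bot
  have e_top := hasDerivAt_integral_logDeriv_mul_horizontal d hab hft hf't hfc hf'c hfdc hfd'c hgc
    hδ h_top
  have e_left := hasDerivAt_integral_logDeriv_mul_vertical a hcd hft hf't hfc hf'c hfdc hfd'c hgc
    hδ h_left
  have e_right := hasDerivAt_integral_logDeriv_mul_vertical b hcd hft hf't hfc hf'c hfdc hfd'c hgc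
    hδ h_right
  have key : HasDerivAt (fun t ↦ rectBoundaryIntegral (fun w ↦ deriv (f t) w / f t w * g w) a b c d)
      (rectBoundaryIntegral (logDerivVariation f fd g t₁) a b c d) t₁ := by
    simp only [rectBoundaryIntegral]
    exact ((e_bot.sub e_top).add (e_right.const_mul I)).sub (e_left.const_mul I)
  -- rewrite the derivative: `(ḟ/f)' g = ((ḟ/f) g)' - (ḟ/f) g'` on `∂K`, and `∮ ((ḟ/f) g)' = 0`
  have h0₁ : ∀ w ∈ rectBoundarySet a b c d, f t₁ w ≠ 0 := h0
  have han : ∀ w ∈ rectBoundarySet a b c d,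
      AnalyticAt ℂ (fun w ↦ fd t₁ w / f t₁ w * g w) w := fun w hw ↦
    ((hfd₁.analyticAt w).div (hf₁.analyticAt w) (h0₁ w hw)).mul (hg.analyticAt w)
  have hcQ : ∀ w ∈ rectBoundarySet a b c d,
      ContinuousAt (fun w ↦ (-1) * (fd t₁ w / f t₁ w * deriv g w)) w := fun w hw ↦
    ((((hfd₁.continuous.continuousAt).div (hf₁.continuous.continuousAt) (h0₁ w hw)).mul
      (hg.analyticAt w).deriv.continuousAt).const_mul (-1 : ℂ))
  have mem_bot : ∀ x ∈ Icc a b, ((x : ℂ) + c * I) ∈ rectBoundarySet a b c d :=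
    fun x hx ↦ Or.inl (Or.inl ⟨x, hx, rfl⟩)
  have mem_top : ∀ x ∈ Icc a b, ((x : ℂ) + d * I) ∈ rectBoundarySet a b c d :=
    fun x hx ↦ Or.inl (Or.inr ⟨x, hx, rfl⟩)
  have mem_left : ∀ y ∈ Icc c d, ((a : ℂ) + y * I) ∈ rectBoundarySet a b c d :=
    fun y hy ↦ Or.inr (Or.inl ⟨y, hy, rfl⟩)
  have mem_right : ∀ y ∈ Icc c d, ((b : ℂ) + y * I) ∈ rectBoundarySet a b c d :=
    fun y hy ↦ Or.inr (Or.inr ⟨y, hy, rfl⟩)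
  have hval : rectBoundaryIntegral (logDerivVariation f fd g t₁) a b c d =
      -rectBoundaryIntegral (fun w ↦ fd t₁ w / f t₁ w * deriv g w) a b c d := by
    rw [rectBoundaryIntegral_congr (G := fun w ↦ deriv (fun w ↦ fd t₁ w / f t₁ w * g w) w +
          (-1) * (fd t₁ w / f t₁ w * deriv g w)) hab hcd
        (fun x hx ↦ logDerivVariation_eq hf₁ hfd₁ hg (h0₁ _ (mem_bot x hx)))
        (fun x hx ↦ logDerivVariation_eq hf₁ hfd₁ hg (h0₁ _ (mem_top x hx)))
        (fun y hy ↦ logDerivVariation_eq hf₁ hfd₁ hg (h0₁ _ (mem_left y hy)))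
        (fun y hy ↦ logDerivVariation_eq hf₁ hfd₁ hg (h0₁ _ (mem_right y hy))),
      rectBoundaryIntegral_add hab hcd
        (fun x hx ↦ (han _ (mem_bot x hx)).deriv.continuousAt)
        (fun x hx ↦ (han _ (mem_top x hx)).deriv.continuousAt)
        (fun y hy ↦ (han _ (mem_left y hy)).deriv.continuousAt)
        (fun y hy ↦ (han _ (mem_right y hy)).deriv.continuousAt)
        (fun x hx ↦ hcQ _ (mem_bot x hx)) (fun x hx ↦ hcQ _ (mem_top x hx))
        (fun y hy ↦ hcQ _ (mem_left y hy)) (fun y hy ↦ hcQ _ (mem_right y hy)),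
      rectBoundaryIntegral_deriv_eq_zero hab hcd (fun x hx ↦ han _ (mem_bot x hx))
        (fun x hx ↦ han _ (mem_top x hx)) (fun y hy ↦ han _ (mem_left y hy))
        (fun y hy ↦ han _ (mem_right y hy)),
      rectBoundaryIntegral_const_mul]
    ring
  rw [hval] at key
  exact key

/-- **Local constancy of the number of zeros in `K`.** Under the hypotheses of the variation
formula with `f_t`, `ḟ_t` entire for all `t`: for `|t − t₁| ≤ δ`, `f_t` has no zero on `∂K` and
`∮_{∂K} f_t'/f_t = ∮_{∂K} f_{t₁}'/f_{t₁}` (the variation formula with `g ≡ 1` gives derivative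
`0` on the whole interval). [folklore] -/
theorem exists_rectBoundaryIntegral_logDeriv_eq_nhds (hab : a ≤ b) (hcd : c ≤ d)
    (hft : ∀ t w, HasDerivAt (fun s ↦ f s w) (fd t w) t)
    (hf't : ∀ t w, HasDerivAt (fun s ↦ deriv (f s) w) (deriv (fd t) w) t)
    (hfc : Continuous (Function.uncurry f)) (hf'c : Continuous fun p : ℝ × ℂ ↦ deriv (f p.1) p.2)
    (hfdc : Continuous (Function.uncurry fd))
    (hfd'c : Continuous fun p : ℝ × ℂ ↦ deriv (fd p.1) p.2)
    (hf : ∀ t, Differentiable ℂ (f t)) (hfd : ∀ t, Differentiable ℂ (fd t))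
    (h0 : ∀ w ∈ rectBoundarySet a b c d, f t₁ w ≠ 0) :
    ∃ δ > 0, ∀ t : ℝ, |t - t₁| ≤ δ → (∀ w ∈ rectBoundarySet a b c d, f t w ≠ 0) ∧
      rectBoundaryIntegral (fun w ↦ deriv (f t) w / f t w) a b c d =
        rectBoundaryIntegral (fun w ↦ deriv (f t₁) w / f t₁ w) a b c d := by
  obtain ⟨δ, hδ, hne⟩ := exists_forall_ne_zero_nhds_of_compact (F := Function.uncurry f) hfc
    (isCompact_rectBoundarySet a b c d) h0
  refine ⟨δ, hδ, fun t ht ↦ ⟨hne t ht, ?_⟩⟩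
  -- derivative zero on the interval `[t₁ - δ, t₁ + δ]`
  set φ : ℝ → ℂ := fun t ↦ rectBoundaryIntegral (fun w ↦ deriv (f t) w / f t w) a b c d with hφ
  have hder : ∀ s ∈ Icc (t₁ - δ) (t₁ + δ), HasDerivWithinAt φ 0 (Icc (t₁ - δ) (t₁ + δ)) s := by
    intro s hs
    have hs' : |s - t₁| ≤ δ := abs_le.2 ⟨by linarith [hs.1], by linarith [hs.2]⟩
    have h := hasDerivAt_rectBoundaryIntegral_logDeriv_mul (g := fun _ ↦ (1 : ℂ)) (t₁ := s) hab hcd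
      hft hf't hfc hf'c hfdc hfd'c (hf s) (hfd s) (differentiable_const 1) (hne s hs')
    have hzero : -rectBoundaryIntegral (fun w ↦ fd s w / f s w * deriv (fun _ ↦ (1 : ℂ)) w) a b c d
        = 0 := by
      simp [rectBoundaryIntegral]
    rw [hzero] at h
    simp only [mul_one] at h
    exact h.hasDerivWithinAt
  have hconv : Convex ℝ (Icc (t₁ - δ) (t₁ + δ)) := convex_Icc _ _
  have ht₁ : t₁ ∈ Icc (t₁ - δ) (t₁ + δ) := ⟨by linarith, by linarith⟩
  have htI : t ∈ Icc (t₁ - δ) (t₁ + δ) :=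
    ⟨by linarith [(abs_le.1 ht).1], by linarith [(abs_le.1 ht).2]⟩
  have := hconv.norm_image_sub_le_of_norm_hasDerivWithin_le hder (fun _ _ ↦ (norm_zero).le) ht₁ htI
  rw [zero_mul, norm_le_zero_iff, sub_eq_zero] at this
  exact this

/-- The weighted argument principle in the `rectBoundaryIntegral` notation of this file:
`∮_{∂K} (f'/f) g = 2πi Σ_{ρ ∈ K°, f(ρ) = 0} m(ρ) g(ρ)` for `f`, `g` analytic on the closed
rectangle and `f ≠ 0` on `∂K` (`Literature.Analysis.Complex.integral_boundary_rect_logDeriv_mul`).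
[cite: Conway1978, Ch. V Thm. 3.6] -/
theorem rectBoundaryIntegral_logDeriv_mul_eq_finsum {F g : ℂ → ℂ} (hab : a < b) (hcd : c < d)
    (hF : AnalyticOnNhd ℂ F (Icc a b ×ℂ Icc c d)) (hg : AnalyticOnNhd ℂ g (Icc a b ×ℂ Icc c d))
    (h0 : ∀ w ∈ rectBoundarySet a b c d, F w ≠ 0) :
    rectBoundaryIntegral (fun z ↦ deriv F z / F z * g z) a b c d =
      2 * Real.pi * I * ∑ᶠ ρ ∈ {ρ : ℂ | F ρ = 0 ∧ ρ ∈ Ioo a b ×ℂ Ioo c d},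
        ((meromorphicOrderAt F ρ).untop₀ : ℂ) * g ρ := by
  rw [rectBoundaryIntegral]
  exact integral_boundary_rect_logDeriv_mul hab hcd hF hg
    (fun x hx ↦ h0 _ (Or.inl (Or.inl ⟨x, hx, rfl⟩)))
    (fun x hx ↦ h0 _ (Or.inl (Or.inr ⟨x, hx, rfl⟩)))
    (fun y hy ↦ h0 _ (Or.inr (Or.inl ⟨y, hy, rfl⟩)))
    (fun y hy ↦ h0 _ (Or.inr (Or.inr ⟨y, hy, rfl⟩)))

end Family

end Literature.Analysis.Complex

end
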